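import Literature.NumberTheory.Automorphic.UnitaryGroupBorelRingModulus
import Literature.NumberTheory.Automorphic.UnitaryGroupPrincipalSeriesExponents
import Literature.NumberTheory.Automorphic.UnitaryGroupGlobalGenericity
import HarnessLib

/-!
# The Weyl conjugate of a torus element of `U(σ, Φ₃)`: `w₀ d(α, β, ᾱ⁻¹) w₀⁻¹ = d(ᾱ⁻¹, β, α)`, and `χ(ʷt) = (wχ)(t)`

Topic `NumberTheory/Automorphic`; namespace `Literature.NumberTheory.Automorphic.UnitaryGroup`.  THEOREMS ONLY: no definition, no named
fact, no `sorry`, no instance declaration, no notation.  Registry pub/hodgecm-mathlib F0∕P3, T3b statement tree, node N1, brick (T-ℓ) «the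
torus acts on the open-cell line by `wχ`», file T3b: the TORUS ALGEBRA of the scalar check
`δ^{-1∕2}(t) · (χ·δ^{1∕2})(ʷt) · δ_B(t) = wχ(t)` (with T1 ★ `SmoothIndCellFunTorusTransport`, T2 `CMBorelTorusConjHaar`).

## The mathematics ([Rogawski1990, §1.10 p. 9, §12.2 p. 173]; [Casselman1995, §6.4])

`R` a commutative ring with involution `σ`, `J = Φ₃` the antidiagonal form, `U = U(σ, Φ₃)(R)` (★ `unitaryGroupOfForm`), `T ≤ B ≤ U`
the diagonal torus and the Borel (★ `torusU`, `borelU`), `w₀ ∈ U` the element whose MATRIX IS `Φ₃` (★ F1 `weylLongU`; here any `w₀`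
with `↑w₀ = J`).  For `t = diag(d₀, d₁, d₂) ∈ T`:
* `coe_weylLong_mul_glDiagonal` — `w₀ · diag(d) = diag(d ∘ rev) · w₀`, so `ʷt := w₀ t w₀⁻¹ = diag(d₂, d₁, d₀) ∈ T`
  (`weylConj_mem_torusU`, `glDiagonal_rev_eq_weylConj`), and `ʷt ∈ B` with `proj(ʷt) = ʷt` (`proj_weylConj`);
* `torusEntry_zero_weylConj` — `(ʷt)₀₀ = d₂ = σ(d₀)⁻¹` (★ `HeisRing.torus_relations`: `σ(d₀) d₂ = 1`); `torusDetNormOne_weylConj` — `det ʷt = det t`;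
* **`torusCharPair_weylConj`** — `χ(ʷt) = (wχ)(t)` for `χ = (χ₁, χ₂)` (★ `torusCharPair`) and `wχ = (χ̄₁⁻¹, χ₂)` (★ `weylTorusCharPair`):
  print's «`w(χ₁, χ₂) = (χ̄₁⁻¹, χ₂)`» IS conjugation by `w₀`;
* `distribHaarChar_torusEntry_zero_weylConj` — `‖(ʷt)₀₀‖ = ‖t₀₀‖⁻¹` (★ `HeisRing.distribHaarChar_torus`), the modulus bookkeeping
  `δ_B^{1∕2}(ʷt) = δ_B^{-1∕2}(t)` once ★ `rootDeltaChar_cmBorel_torus` (`δ^{1∕2}(t) = ‖t₀₀‖`) is applied (Summits side, file T3);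
* §2 the CM instance (`R = ∏_{w∣v} L_w`, `σ = c ⊗ 1`, `J = cmLocalForm L 3 v`): `cmTorusCharPair L v χ₁ χ₂ ʷt = cmWeylTorusCharPair L v χ₁ χ₂ t`.
HC_CM is proved only modulo the printed citations until rung 0 closes; this file discharges no named fact.

## References
* [Rogawski1990] J. D. Rogawski, *Automorphic Representations of Unitary Groups in Three Variables* (1990), §1.10 p. 9 («`Φ₃` normalises `T`»),
  §12.2 p. 173 («`w(χ₁, χ₂) = (χ̄₁⁻¹, χ₂)`»).
* [Casselman1995] W. Casselman, *Introduction to the theory of admissible representations of `p`-adic reductive groups* (1995), §6.4, L. 7.1.1.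
-/

set_option autoImplicit false

noncomputable section

open scoped MatrixGroups NNReal
open MeasureTheory

namespace Literature.NumberTheory.Automorphic

namespace UnitaryGroup

/-! ## §1 Generic ring `R` with involution, `J = Φ₃`, `w₀` the element with matrix `Φ₃` -/

section Generic

variable {R : Type*} [CommRing R] (σ : R →+* R) {J : Matrix (Fin 3) (Fin 3) R} (hJ : J = (StdForm.antidiagonal 3).over R)
  (w₀ : ↥(unitaryGroupOfForm σ J)) (hw₀ : ((w₀ : GL (Fin 3) R) : Matrix (Fin 3) (Fin 3) R) = J)

include hJ hw₀ in
/-- **`w₀ · diag(d) = diag(d ∘ rev) · w₀`** in `GL₃(R)` for the antidiagonal `w₀ = Φ₃` (`Φ₃` normalises the diagonal torus and reverses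
the entries). [cite: Rogawski1990, §1.10 p. 9] -/
theorem coe_weylLong_mul_glDiagonal (d : Fin 3 → Rˣ) :
    (w₀ : GL (Fin 3) R) * glDiagonal 3 R d = glDiagonal 3 R (fun i => d i.rev) * (w₀ : GL (Fin 3) R) := by
  refine Matrix.GeneralLinearGroup.ext fun i j => ?_
  rw [Units.val_mul, Units.val_mul, coe_glDiagonal, coe_glDiagonal, Matrix.mul_diagonal, Matrix.diagonal_mul, hw₀, hJ,
    StdForm.antidiagonal_over_apply]
  by_cases hij : j = i.rev
  · subst hij
    rw [if_pos rfl, one_mul, mul_one]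
  · rw [if_neg hij, zero_mul, mul_zero]

include hJ hw₀ in
/-- `w₀ · diag(d) · w₀⁻¹ = diag(d ∘ rev)` in `GL₃(R)`. [cite: Rogawski1990, §1.10 p. 9] -/
theorem weylLong_mul_glDiagonal_mul_inv (d : Fin 3 → Rˣ) :
    (w₀ : GL (Fin 3) R) * glDiagonal 3 R d * (w₀ : GL (Fin 3) R)⁻¹ = glDiagonal 3 R (fun i => d i.rev) := by
  rw [coe_weylLong_mul_glDiagonal σ hJ w₀ hw₀ d, mul_inv_cancel_right]

include hJ hw₀ in
/-- **`ʷt := w₀ t w₀⁻¹ ∈ T`** for `t ∈ T`. [cite: Rogawski1990, §1.10 p. 9] -/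
theorem weylConj_mem_torusU (t : ↥(torusU σ J)) :
    w₀ * (t : ↥(unitaryGroupOfForm σ J)) * w₀⁻¹ ∈ torusU σ J := by
  obtain ⟨d, hd⟩ := (mem_torusU_iff _).1 t.2
  refine (mem_torusU_iff _).2 ⟨fun i => d i.rev, ?_⟩
  rw [Subgroup.coe_mul, Subgroup.coe_mul, Subgroup.coe_inv, ← hd, weylLong_mul_glDiagonal_mul_inv σ hJ w₀ hw₀ d]

include hJ hw₀ in
/-- the diagonal of `ʷt` is the reversed diagonal of `t`: `diag(d ∘ rev) = ʷt`. [cite: Rogawski1990, §1.10 p. 9] -/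
theorem glDiagonal_rev_eq_weylConj (t : ↥(torusU σ J)) {d : Fin 3 → Rˣ}
    (hd : glDiagonal 3 R d = ((t : ↥(unitaryGroupOfForm σ J)) : GL (Fin 3) R)) :
    glDiagonal 3 R (fun i => d i.rev) =
      (((⟨w₀ * (t : ↥(unitaryGroupOfForm σ J)) * w₀⁻¹, weylConj_mem_torusU σ hJ w₀ hw₀ t⟩ : ↥(torusU σ J)) :
        ↥(unitaryGroupOfForm σ J)) : GL (Fin 3) R) := by
  change glDiagonal 3 R (fun i => d i.rev) = ((w₀ * (t : ↥(unitaryGroupOfForm σ J)) * w₀⁻¹ : ↥(unitaryGroupOfForm σ J)) : GL (Fin 3) R)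
  rw [Subgroup.coe_mul, Subgroup.coe_mul, Subgroup.coe_inv, ← hd, weylLong_mul_glDiagonal_mul_inv σ hJ w₀ hw₀ d]

include hJ hw₀ in
/-- `ʷt ∈ B`. [cite: Rogawski1990, §1.10 p. 9] -/
theorem weylConj_mem_borelU (t : ↥(torusU σ J)) :
    w₀ * (t : ↥(unitaryGroupOfForm σ J)) * w₀⁻¹ ∈ borelU σ J :=
  torusU_le_borelU σ J (weylConj_mem_torusU σ hJ w₀ hw₀ t)

include hw₀ in
/-- **The Levi projection fixes `ʷt`**: `proj ⟨ʷt, _⟩ = ⟨ʷt, _⟩` (★ `ParabolicTriple.proj_apply_of_mem_M`). [cite: BernsteinZelevinsky1977, §1.8] -/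
theorem proj_weylConj (t : ↥(torusU σ J)) :
    (borelTriple σ J hJ).proj ⟨w₀ * (t : ↥(unitaryGroupOfForm σ J)) * w₀⁻¹, weylConj_mem_borelU σ hJ w₀ hw₀ t⟩ =
      ⟨w₀ * (t : ↥(unitaryGroupOfForm σ J)) * w₀⁻¹, weylConj_mem_torusU σ hJ w₀ hw₀ t⟩ :=
  Subtype.ext ((borelTriple σ J hJ).proj_apply_of_mem_M _ (weylConj_mem_torusU σ hJ w₀ hw₀ t))

include hw₀ in
/-- **`(ʷt)₀₀ = σ(t₀₀)⁻¹`** (`(ʷt)₀₀ = d₂` and the torus relation `σ(d₀) d₂ = 1`, ★ `HeisRing.torus_relations`). [cite: Rogawski1990, §1.10 p. 9] -/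
theorem torusEntry_zero_weylConj (t : ↥(torusU σ J)) :
    torusEntry σ J 0 ⟨w₀ * (t : ↥(unitaryGroupOfForm σ J)) * w₀⁻¹, weylConj_mem_torusU σ hJ w₀ hw₀ t⟩ =
      (Units.map (σ : R →* R) (torusEntry σ J 0 t))⁻¹ := by
  obtain ⟨d, hd⟩ := (mem_torusU_iff _).1 t.2
  rw [torusEntry_eq_of_glDiagonal_eq σ J 0 _ _ (glDiagonal_rev_eq_weylConj σ hJ w₀ hw₀ t hd),
    torusEntry_eq_of_glDiagonal_eq σ J 0 t d hd]
  obtain ⟨-, -, h02⟩ := HeisRing.torus_relations σ hJ t hd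
  have hu : Units.map (σ : R →* R) (d 0) * d 2 = 1 :=
    Units.ext (by rw [Units.val_mul, Units.coe_map, MonoidHom.coe_coe, Units.val_one]; exact h02)
  exact (eq_inv_of_mul_eq_one_right hu)

include hw₀ in
/-- **`det ʷt = det t`** (as elements of `E¹`). [cite: Rogawski1990, §12.1 p. 171] -/
theorem torusDetNormOne_weylConj (t : ↥(torusU σ J)) :
    torusDetNormOne σ J hJ ⟨w₀ * (t : ↥(unitaryGroupOfForm σ J)) * w₀⁻¹, weylConj_mem_torusU σ hJ w₀ hw₀ t⟩ =
      torusDetNormOne σ J hJ t := by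
  obtain ⟨d, hd⟩ := (mem_torusU_iff _).1 t.2
  apply Subtype.ext
  rw [coe_torusDetNormOne, coe_torusDetNormOne, torusDet_eq_of_glDiagonal_eq σ J _ _ (glDiagonal_rev_eq_weylConj σ hJ w₀ hw₀ t hd),
    torusDet_eq_of_glDiagonal_eq σ J t d hd, Fin.prod_univ_three, Fin.prod_univ_three]
  have h0 : (Fin.rev 0 : Fin 3) = 2 := rfl
  have h1 : (Fin.rev 1 : Fin 3) = 1 := rfl
  have h2 : (Fin.rev 2 : Fin 3) = 0 := rfl
  rw [h0, h1, h2]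
  simp only [mul_assoc, mul_comm]

include hw₀ in
/-- **`χ(ʷt) = (wχ)(t)`**: for the character pair `χ = (χ₁, χ₂)` of `T` (★ `torusCharPair`, coordinate `0`), conjugation by `w₀` gives
print's Weyl conjugate `wχ = (χ̄₁⁻¹, χ₂)` (★ `weylTorusCharPair`). [cite: Rogawski1990, §12.2 p. 173] -/
theorem torusCharPair_weylConj (χ₁ : Rˣ →* ℂˣ) (χ₂ : ↥(normOneUnits σ) →* ℂˣ) (t : ↥(torusU σ J)) :
    torusCharPair σ J hJ 0 χ₁ χ₂ ⟨w₀ * (t : ↥(unitaryGroupOfForm σ J)) * w₀⁻¹, weylConj_mem_torusU σ hJ w₀ hw₀ t⟩ =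
      weylTorusCharPair σ J hJ 0 χ₁ χ₂ t := by
  rw [torusCharPair_apply, weylTorusCharPair_apply, torusEntry_zero_weylConj σ hJ w₀ hw₀ t, map_inv,
    torusDetNormOne_weylConj σ hJ w₀ hw₀ t]

end Generic

/-! ### The modulus bookkeeping `‖(ʷt)₀₀‖ = ‖t₀₀‖⁻¹` -/

section Modulus

variable {R : Type*} [CommRing R] [TopologicalSpace R] [IsTopologicalRing R] [LocallyCompactSpace R]
  [MeasurableSpace R] [BorelSpace R] (σ : R →+* R) (hσ : ∀ x, σ (σ x) = x) (hσc : Continuous σ)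
  {J : Matrix (Fin 3) (Fin 3) R} (hJ : J = (StdForm.antidiagonal 3).over R)
  (w₀ : ↥(unitaryGroupOfForm σ J)) (hw₀ : ((w₀ : GL (Fin 3) R) : Matrix (Fin 3) (Fin 3) R) = J)

include hσ hσc hw₀ in
/-- **`‖(ʷt)₀₀‖ = ‖t₀₀‖⁻¹`** (`(ʷt)₀₀ = d₂` and ★ `HeisRing.distribHaarChar_torus`: `‖d₂‖ = ‖d₀‖⁻¹`; `‖·‖ = ` ★ `unitModulusChar R` = Mathlib
`distribHaarChar R`). [cite: Rogawski1990, §2.2] -/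
theorem unitModulusChar_torusEntry_zero_weylConj (t : ↥(torusU σ J)) :
    unitModulusChar R (torusEntry σ J 0 ⟨w₀ * (t : ↥(unitaryGroupOfForm σ J)) * w₀⁻¹, weylConj_mem_torusU σ hJ w₀ hw₀ t⟩) =
      (unitModulusChar R (torusEntry σ J 0 t))⁻¹ := by
  obtain ⟨d, hd⟩ := (mem_torusU_iff _).1 t.2
  rw [torusEntry_eq_of_glDiagonal_eq σ J 0 _ _ (glDiagonal_rev_eq_weylConj σ hJ w₀ hw₀ t hd),
    torusEntry_eq_of_glDiagonal_eq σ J 0 t d hd]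
  exact (HeisRing.distribHaarChar_torus σ hσ hσc hJ t hd).2

end Modulus

/-! ## §2 The CM instance `U(Φ₃)(L⁺_v)`: `cmTorusCharPair (ʷt) = cmWeylTorusCharPair t` -/

section CM

open _root_.NumberField _root_.IsDedekindDomain

variable (L : Type) [Field L] [NumberField L] [IsCMField L] (v : HeightOneSpectrum (𝓞 ↥(maximalRealSubfield L)))
  (w₀ : ↥(unitaryGroupOfForm (conjLocal L (IsCMField.complexConj L) v) (cmLocalForm L 3 v)))
  (hw₀ : Units.val (w₀ : GL (Fin 3) (LocalRing L v)) = cmLocalForm L 3 v)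

include hw₀ in
/-- `ʷt ∈ T(L⁺_v)` at the CM data (`w₀` with matrix `Φ₃ = cmLocalForm L 3 v`, ★ F1). [cite: Rogawski1990, §1.10 p. 9] -/
theorem weylConj_mem_cmTorus (t : ↥(torusU (conjLocal L (IsCMField.complexConj L) v) (cmLocalForm L 3 v))) :
    w₀ * (t : ↥(unitaryGroupOfForm (conjLocal L (IsCMField.complexConj L) v) (cmLocalForm L 3 v))) * w₀⁻¹ ∈
      torusU (conjLocal L (IsCMField.complexConj L) v) (cmLocalForm L 3 v) :=
  weylConj_mem_torusU (conjLocal L (IsCMField.complexConj L) v) (cmLocalForm_eq_over L 3 v) w₀ hw₀ t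

include hw₀ in
/-- `ʷt ∈ B(L⁺_v) = (cmBorelTriple L 3 v).P`. [cite: Rogawski1990, §1.10 p. 9] -/
theorem weylConj_mem_cmBorel (t : ↥(torusU (conjLocal L (IsCMField.complexConj L) v) (cmLocalForm L 3 v))) :
    w₀ * (t : ↥(unitaryGroupOfForm (conjLocal L (IsCMField.complexConj L) v) (cmLocalForm L 3 v))) * w₀⁻¹ ∈ (cmBorelTriple L 3 v).P :=
  weylConj_mem_borelU (conjLocal L (IsCMField.complexConj L) v) (cmLocalForm_eq_over L 3 v) w₀ hw₀ t

include hw₀ in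
/-- **`χ(ʷt) = (wχ)(t)` on `T(L⁺_v)`**: `cmTorusCharPair L v χ₁ χ₂ ⟨w₀ t w₀⁻¹, _⟩ = cmWeylTorusCharPair L v χ₁ χ₂ t`.
[cite: Rogawski1990, §12.2 p. 173] -/
theorem cmTorusCharPair_weylConj (χ₁ : (LocalRing L v)ˣ →* ℂˣ)
    (χ₂ : ↥(normOneUnits (conjLocal L (IsCMField.complexConj L) v)) →* ℂˣ)
    (t : ↥(torusU (conjLocal L (IsCMField.complexConj L) v) (cmLocalForm L 3 v))) :
    cmTorusCharPair L v χ₁ χ₂ ⟨w₀ * (t : ↥(unitaryGroupOfForm (conjLocal L (IsCMField.complexConj L) v) (cmLocalForm L 3 v))) * w₀⁻¹,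
        weylConj_mem_cmTorus L v w₀ hw₀ t⟩ =
      cmWeylTorusCharPair L v χ₁ χ₂ t :=
  torusCharPair_weylConj (conjLocal L (IsCMField.complexConj L) v) (cmLocalForm_eq_over L 3 v) w₀ hw₀ χ₁ χ₂ t

include hw₀ in
/-- `proj ⟨ʷt, _⟩ = ⟨ʷt, _⟩` for the Borel triple of `U(Φ₃)(L⁺_v)`. [cite: BernsteinZelevinsky1977, §1.8] -/
theorem proj_cmBorel_weylConj (t : ↥(torusU (conjLocal L (IsCMField.complexConj L) v) (cmLocalForm L 3 v))) :
    (cmBorelTriple L 3 v).proj ⟨w₀ * (t : ↥(unitaryGroupOfForm (conjLocal L (IsCMField.complexConj L) v) (cmLocalForm L 3 v))) * w₀⁻¹,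
        weylConj_mem_cmBorel L v w₀ hw₀ t⟩ =
      ⟨w₀ * (t : ↥(unitaryGroupOfForm (conjLocal L (IsCMField.complexConj L) v) (cmLocalForm L 3 v))) * w₀⁻¹,
        weylConj_mem_cmTorus L v w₀ hw₀ t⟩ :=
  proj_weylConj (conjLocal L (IsCMField.complexConj L) v) (cmLocalForm_eq_over L 3 v) w₀ hw₀ t

end CM

end UnitaryGroup

end Literature.NumberTheory.Automorphic

end
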